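import Literature.NumberTheory.Automorphic.UnitaryTwoDescentDiscriminantRamified   -- ★ A-p12 (g23): `trace∕det∕disc_eq_smul_of_descent`; brings ★ `RamifiedPlaceEisensteinBasis` (`valued_toPlace_eq_sq_of_ramified`, `galAdicCompletionMap_ne_self_of_uniformizer`), ★ (W1) `UnitaryTwoAntidiagProjectiveDescent` (`map_conj_diagonal_eq_det_inv_smul`), ★ `UnitaryTwoRamifiedTreeAction` (`unitaryGroupOfForm_placeForm_antidiagTwo_eq`, `eq_of_sq_eq_sq`), ★ `ValuedFieldValuativeRelBridge`
import HarnessLib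

/-!
# The projective descent of `U(Φ₂)(L_w)` at a ramified place, TYPE (1): `N(s)·ι(det g) = 1`, the descended discriminant is `(ϖ − σϖ)²` times a SQUARE of `L⁺_v`,
# and the Eisenstein deepness bound `|tr²g − 4det g|_v ≤ |u² + 4v|_v·|det g|_v` from `|α − γ|_w ≤ |ϖ − σϖ|_w` (Labesse–Langlands 1979 §2; Rogawski 1990 §3.6)

Topic `NumberTheory/Automorphic`; namespace `Literature.NumberTheory.Automorphic.UnitaryGroup`.  THEOREMS ONLY (no definition, no instance, no notation, no named fact, no
`sorry`); kernel lane `--supports stmt-HodgeConjecture-24833` (count-neutral).  Cell `pub/hodgecm-mathlib` (D-0151), crux H413; squad F0∕P3c∕LH4, unit U2H_HSide, ROW (1),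
brick (4) «hΦ DISCHARGE» of LH4-p12 (g0) (2026-09-03T23:44:36Z), sub-bricks **(4a) «DESCENT DISCRIMINANT»** and **(4b) «DEPTH»** (dealer LH4-plan (g11) WORD #6 → seat LH4-p07
(g3)).  This is the TYPE-(1) companion of ★ `UnitaryTwoDescentDiscriminantRamified` (the type-(2) parity organ): it supplies the hypotheses `hz hdisc hD hdeep'` of ★ p855714
`exists_torusForm_binders_of_eisenstein_of_deep'` for the descent `g ∈ GL₂(L⁺_v)` of a `G`-regular TYPE-(1) element `U ∈ U(Φ₂)(L_w)` — characteristic polynomial SPLIT in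
`L_w` with distinct NORM-ONE roots `α ≠ γ` — at the EISENSTEIN datum `(u, v)` of the record's uniformiser `ϖ` (`ϖ + σϖ = ι u`, `ϖ·σϖ = −ι v`, ★ `exists_eisenstein_coeffs_of_ramified'`).
HONEST LABEL: HC_CM is proved only modulo the 7 printed citations (2 remaining named inputs: hLiu418 = `stmt-HodgeConjecture-24832`, h413 = `stmt-HodgeConjecture-24833`) until
rung 0 closes; nothing printed is asserted here — local algebra; the (b′) dictionary's `hΦ` stays LH4-p12's assembly.

THE MATHEMATICS (`σ = σ_w`, `ι = toPlace v w : L⁺_v →+* L_w`, `Φ₂ = (0 1; 1 0)`, descent `diag(1,a)·U·diag(1,a)⁻¹ = s·ι(g)` with `σa = −a ≠ 0`, `s ≠ 0` — ★ (W1)).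
§1 (any fields).  (i) `tr U = α + γ`, `det U = αγ` for distinct roots of `χ_U`.  (ii) **`s·σs·ι(det g) = 1`**: ★ `map_conj_diagonal_eq_det_inv_smul` says `σ(s·ι g) = (det U)⁻¹·s·ι g`,
so `σs = (det U)⁻¹ s` (compare a non-zero entry of `ι g`), and `det U = s²·ι(det g)` (★ `det_eq_smul_of_descent`) — this is the unitarity of `U` read through the descent
(`σ(U)ᵀΦ₂U = N(s)·det(g)·Φ₂`).  (iii) Hence for NORM-ONE roots (`ασα = γσγ = 1`) the element **`y := (α − γ)∕s` is ANTI-FIXED**: `σy = (α⁻¹ − γ⁻¹)∕σs = −(α − γ)∕(αγ·σs)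
= −(α − γ)∕(s²ι(det g)·σs) = −y`.  §2 (at a ramified CM place `w ∣ v`, `ϖ` a uniformiser of `L_w`, so `ϖ ≠ σϖ` ★).  **(4a)** `z_E := y∕(ϖ − σϖ)` is `σ`-FIXED, hence `= ι z`
(★ `exists_toPlace_eq_of_galAdicCompletionMap_eq`), `z ≠ 0`, and `ι(tr²g − 4det g) = (tr²U − 4det U)∕s² = (α − γ)²∕s² = y² = (ϖ − σϖ)²·ι(z)² = ι((u² + 4v)·z²)` because
`ι(u² + 4v) = (ϖ + σϖ)² − 4ϖσϖ = (ϖ − σϖ)²`; `ι` is injective ⇒ **`tr²g − 4det g = (u² + 4v)·z²`** with **`ι z·(ϖ − σϖ)·s = α − γ`** (the eigenvalue gap in descended tokens) and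
`u² + 4v ≠ 0`.  **(4b)** `|ι x|_w = |x|_v²` (★ `valued_toPlace_eq_sq_of_ramified`) and `|α| = |γ| = 1`: `|tr²g − 4det g|_v ≤ |u² + 4v|_v·|det g|_v ⟺ |α − γ|²∕|s|² ≤
|ϖ − σϖ|²·|αγ|∕|s|² ⟸ |α − γ|_w ≤ |ϖ − σϖ|_w`, i.e. eigenvalue depth `N ≥ d` (the datum's `|ϖ − σϖ| = |ϖ|^d`); stated in the `ValuativeRel` currency of ★ p855714.

* §1 `trace_eq_add_of_isRoot_of_isRoot`, `det_eq_mul_of_isRoot_of_isRoot`, **`mul_map_mul_det_eq_one_of_descent`**, **`map_sub_div_eq_neg_of_descent`**.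
* §2 `valued_eq_one_of_mul_galAdicCompletionMap_eq_one`, `toPlace_eisenstein_disc_eq_sq`, `eisenstein_disc_ne_zero`,
  **`exists_disc_eq_eisenstein_mul_sq_of_typeOne`** (4a), **`valuation_disc_le_of_typeOne_of_le`**, **`valuation_disc_le_of_typeOne_of_depth`** (4b).

## References
* [LabesseLanglands1979] J.-P. Labesse, R. P. Langlands, *L-indistinguishability for SL(2)*, Canad. J. Math. 31 (1979): §2 pp. 7–8 (the quadratic tori of `SL₂`, Eisenstein form).
* [Rogawski1990] J. D. Rogawski, *Automorphic Representations of Unitary Groups in Three Variables*, Ann. of Math. Stud. 123 (1990): §3.6 pp. 28–29 (`U(1,1)`, `SU(1,1) ≅ SL₂(F)`; type (1)).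
* [Serre1979] J.-P. Serre, *Local Fields*, GTM 67 (1979): Ch. I §6 Prop. 18 (Eisenstein equations at a totally ramified extension), Ch. II §2.
-/

set_option autoImplicit false

noncomputable section

open scoped WithZero ValuativeRel Matrix MatrixGroups
open Matrix WithZero ValuativeRel NumberField IsDedekindDomain Polynomial

namespace Literature.NumberTheory.Automorphic.UnitaryGroup

open Literature.NumberTheory.Automorphic Literature.NumberTheory.LocalFields

/-! ## §1 Algebra of the descent for a unitary `U` (any fields) -/

section Algebra

variable {F E : Type*} [Field F] [Field E] (ι : F →+* E) (σ : E →+* E)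

/-- For two DISTINCT roots `α ≠ γ` of the characteristic polynomial of a `2 × 2` matrix: `tr M = α + γ`. [cite: LabesseLanglands1979, §2 p. 8] -/
theorem trace_eq_add_of_isRoot_of_isRoot (M : Matrix (Fin 2) (Fin 2) E) {α γ : E} (hα : M.charpoly.IsRoot α) (hγ : M.charpoly.IsRoot γ) (hαγ : α ≠ γ) :
    M.trace = α + γ := by
  have e : ∀ z : E, M.charpoly.eval z = z ^ 2 - M.trace * z + M.det := fun z => by
    rw [Matrix.charpoly_fin_two, Matrix.trace_fin_two]; simp
  have hα' : α ^ 2 - M.trace * α + M.det = 0 := by rw [← e]; exact hα.eq_zero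
  have hγ' : γ ^ 2 - M.trace * γ + M.det = 0 := by rw [← e]; exact hγ.eq_zero
  have hsub : (α - γ) * (α + γ - M.trace) = 0 := by linear_combination hα' - hγ'
  have h := (mul_eq_zero.1 hsub).resolve_left (sub_ne_zero.2 hαγ)
  linear_combination -h

/-- For two DISTINCT roots `α ≠ γ` of the characteristic polynomial of a `2 × 2` matrix: `det M = α·γ`. [cite: LabesseLanglands1979, §2 p. 8] -/
theorem det_eq_mul_of_isRoot_of_isRoot (M : Matrix (Fin 2) (Fin 2) E) {α γ : E} (hα : M.charpoly.IsRoot α) (hγ : M.charpoly.IsRoot γ) (hαγ : α ≠ γ) :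
    M.det = α * γ := by
  have e : ∀ z : E, M.charpoly.eval z = z ^ 2 - M.trace * z + M.det := fun z => by
    rw [Matrix.charpoly_fin_two, Matrix.trace_fin_two]; simp
  have hα' : α ^ 2 - M.trace * α + M.det = 0 := by rw [← e]; exact hα.eq_zero
  rw [trace_eq_add_of_isRoot_of_isRoot M hα hγ hαγ] at hα'
  linear_combination hα'

/-- **`N(s)·ι(det g) = 1` — THE UNITARITY OF `U` READ THROUGH THE DESCENT.**  For `U ∈ U(σ, Φ₂)`, `σa = −a ≠ 0`, `s ≠ 0`, `g ∈ GL₂(F)` with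
`diag(1,a)·U·diag(1,a)⁻¹ = s·ι(g)` and `ι(F)` `σ`-fixed: `s·σ(s)·ι(det g) = 1` (★ `σ(s·ιg) = (det U)⁻¹·(s·ιg)` gives `σs = (det U)⁻¹·s`, and `det U = s²·ι(det g)`).
[cite: Rogawski1990, §3.6 pp. 28–29] -/
theorem mul_map_mul_det_eq_one_of_descent {U : GL (Fin 2) E} (hU : U ∈ unitaryGroupOfForm σ !![(0 : E), 1; 1, 0]) {a : E} (ha : σ a = -a) (ha0 : a ≠ 0)
    (hσι : ∀ x, σ (ι x) = ι x) {s : E} (hs : s ≠ 0) {g : GL (Fin 2) F}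
    (hsg : Matrix.diagonal ![1, a] * (U : Matrix (Fin 2) (Fin 2) E) * Matrix.diagonal ![1, a⁻¹] = s • (g : Matrix (Fin 2) (Fin 2) F).map ι) :
    s * σ s * ι (g : Matrix (Fin 2) (Fin 2) F).det = 1 := by
  have hfix := map_conj_diagonal_eq_det_inv_smul σ hU ha ha0
  rw [hsg] at hfix
  -- `σ(s • ιg) = σs • ιg`
  have hmap : (s • (g : Matrix (Fin 2) (Fin 2) F).map ι).map σ = σ s • (g : Matrix (Fin 2) (Fin 2) F).map ι := by
    ext i j
    simp only [Matrix.map_apply, Matrix.smul_apply, smul_eq_mul, map_mul, hσι]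
  rw [hmap, smul_smul] at hfix
  -- some entry of `ιg` is non-zero
  have hdetg : ι (g : Matrix (Fin 2) (Fin 2) F).det ≠ 0 :=
    (map_ne_zero ι).2 (isUnit_iff_ne_zero.1 (g.isUnit.map Matrix.detMonoidHom))
  obtain ⟨i, j, hij⟩ : ∃ i j, ((g : Matrix (Fin 2) (Fin 2) F).map ι) i j ≠ 0 := by
    by_contra hall
    apply hdetg
    have h0 : (g : Matrix (Fin 2) (Fin 2) F).map ι = 0 := by
      ext i j
      by_contra hij
      exact hall ⟨i, j, hij⟩
    rw [RingHom.map_det, RingHom.mapMatrix_apply, h0, Matrix.det_zero]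
  have hentry := congrFun (congrFun hfix i) j
  simp only [Matrix.smul_apply, smul_eq_mul] at hentry
  have hσs : σ s = ((U : Matrix (Fin 2) (Fin 2) E).det)⁻¹ * s := mul_right_cancel₀ hij hentry
  have hdetU : (U : Matrix (Fin 2) (Fin 2) E).det = s ^ 2 * ι (g : Matrix (Fin 2) (Fin 2) F).det := det_eq_smul_of_descent ι ha0 hsg
  have hdetU0 : (U : Matrix (Fin 2) (Fin 2) E).det ≠ 0 := by rw [hdetU]; exact mul_ne_zero (pow_ne_zero _ hs) hdetg
  rw [hσs, hdetU]
  field_simp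

/-- **THE EIGENVALUE GAP OVER THE SCALAR IS ANTI-FIXED (type (1)).**  Under the descent, for distinct NORM-ONE roots `α ≠ γ` of `χ_U` (`ασα = γσγ = 1`):
`σ((α − γ)∕s) = −(α − γ)∕s` — `σ((α − γ)∕s) = (α⁻¹ − γ⁻¹)∕σs = −(α − γ)∕(αγ·σs)` and `αγ·σs = det U·σs = s²ι(det g)σs = s`. [cite: Rogawski1990, §3.6 pp. 28–29] [cite: LabesseLanglands1979, §2 p. 8] -/
theorem map_sub_div_eq_neg_of_descent {U : GL (Fin 2) E} (hU : U ∈ unitaryGroupOfForm σ !![(0 : E), 1; 1, 0]) {a : E} (ha : σ a = -a) (ha0 : a ≠ 0)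
    (hσι : ∀ x, σ (ι x) = ι x) {s : E} (hs : s ≠ 0) {g : GL (Fin 2) F}
    (hsg : Matrix.diagonal ![1, a] * (U : Matrix (Fin 2) (Fin 2) E) * Matrix.diagonal ![1, a⁻¹] = s • (g : Matrix (Fin 2) (Fin 2) F).map ι)
    {α γ : E} (hα : (U : Matrix (Fin 2) (Fin 2) E).charpoly.IsRoot α) (hγ : (U : Matrix (Fin 2) (Fin 2) E).charpoly.IsRoot γ) (hαγ : α ≠ γ)
    (hα1 : α * σ α = 1) (hγ1 : γ * σ γ = 1) :
    σ ((α - γ) / s) = -((α - γ) / s) := by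
  have hN := mul_map_mul_det_eq_one_of_descent ι σ hU ha ha0 hσι hs hsg
  have hdetU : (U : Matrix (Fin 2) (Fin 2) E).det = s ^ 2 * ι (g : Matrix (Fin 2) (Fin 2) F).det := det_eq_smul_of_descent ι ha0 hsg
  have hdet := det_eq_mul_of_isRoot_of_isRoot (U : Matrix (Fin 2) (Fin 2) E) hα hγ hαγ
  -- `αγ·σs = s`
  have hprod : α * γ * σ s = s := by
    rw [← hdet, hdetU]
    linear_combination s * hN
  have hα0 : α ≠ 0 := fun h => by rw [h, zero_mul] at hα1; exact zero_ne_one hα1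
  have hγ0 : γ ≠ 0 := fun h => by rw [h, zero_mul] at hγ1; exact zero_ne_one hγ1
  have hσα : σ α = α⁻¹ := eq_inv_of_mul_eq_one_right hα1
  have hσγ : σ γ = γ⁻¹ := eq_inv_of_mul_eq_one_right hγ1
  have hσs : σ s = s / (α * γ) := by
    rw [eq_div_iff (mul_ne_zero hα0 hγ0)]
    linear_combination hprod
  rw [map_div₀, map_sub, hσα, hσγ, hσs]
  field_simp
  ring

end Algebra

/-! ## §2 At a ramified CM place: (4a) the discriminant square class, (4b) the Eisenstein deepness bound -/

section Place

variable (L : Type) [Field L] [NumberField L] [IsCMField L] (v : HeightOneSpectrum (𝓞 ↥(maximalRealSubfield L)))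
  (w : PlacesOver L v) (hw : IsCMField.complexConj L • w.1 = w.1)

omit [IsCMField L] in
/-- In `ℤᵐ⁰`: `x² ≤ y² ⟹ x ≤ y` (squaring is strictly monotone; a local copy of ★ `RamifiedPlaceLevelNorms.le_of_sq_le_sq_withZero`, not imported to keep this file's
closure light). [cite: Serre1979, Ch. II §2] -/
private theorem le_of_sq_le_sq_aux {x y : WithZero (Multiplicative ℤ)} (h : x ^ 2 ≤ y ^ 2) : x ≤ y := by
  by_contra hlt
  rw [not_le] at hlt
  exact absurd h (not_le.2 (pow_lt_pow_left₀ hlt zero_le two_ne_zero))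

include hw in
/-- A norm-one element has valuation `1`: `α·σ_w α = 1 ⟹ |α|_w = 1` (`|σ_w α| = |α|`). [cite: Serre1979, Ch. II §2] -/
theorem valued_eq_one_of_mul_galAdicCompletionMap_eq_one {α : w.1.adicCompletion L}
    (hα1 : α * galAdicCompletionMap (L := L) (IsCMField.complexConj L) hw α = 1) : Valued.v α = 1 := by
  have h := congrArg Valued.v hα1
  rw [map_mul, valued_galAdicCompletionMap, map_one, ← pow_two, ← one_pow 2] at h
  exact eq_of_sq_eq_sq h

/-- **`ι(u² + 4v) = (ϖ − σϖ)²`** for the Eisenstein datum `ϖ + σϖ = ι u`, `ϖ·σϖ = −ι v`. [cite: Serre1979, Ch. I §6 Prop. 18] -/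
theorem toPlace_eisenstein_disc_eq_sq {ϖ : w.1.adicCompletion L} {u v' : v.adicCompletion ↥(maximalRealSubfield L)}
    (htr : ϖ + galAdicCompletionMap (L := L) (IsCMField.complexConj L) hw ϖ = toPlace v w u)
    (hnm : ϖ * galAdicCompletionMap (L := L) (IsCMField.complexConj L) hw ϖ = -toPlace v w v') :
    toPlace v w (u ^ 2 + 4 * v') = (ϖ - galAdicCompletionMap (L := L) (IsCMField.complexConj L) hw ϖ) ^ 2 := by
  rw [map_add, map_mul, map_pow, map_ofNat, ← htr, show toPlace v w v' = -(ϖ * galAdicCompletionMap (L := L) (IsCMField.complexConj L) hw ϖ) by rw [hnm, neg_neg]]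
  ring

include hw in
/-- **The Eisenstein discriminant of a uniformiser is non-zero** at a ramified place: `u² + 4v ≠ 0` (`ι(u² + 4v) = (ϖ − σϖ)²` and `σϖ ≠ ϖ` ★). [cite: Serre1979, Ch. I §6 Prop. 18] -/
theorem eisenstein_disc_ne_zero (he : v.asIdeal.ramificationIdx' w.1.asIdeal ≠ 1) {ϖ : w.1.adicCompletion L} (hϖ : Valued.v ϖ = WithZero.exp (-1 : ℤ))
    {u v' : v.adicCompletion ↥(maximalRealSubfield L)}
    (htr : ϖ + galAdicCompletionMap (L := L) (IsCMField.complexConj L) hw ϖ = toPlace v w u)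
    (hnm : ϖ * galAdicCompletionMap (L := L) (IsCMField.complexConj L) hw ϖ = -toPlace v w v') :
    u ^ 2 + 4 * v' ≠ 0 := by
  intro h0
  have h := toPlace_eisenstein_disc_eq_sq L v w hw htr hnm
  rw [h0, map_zero] at h
  have hδ : ϖ - galAdicCompletionMap (L := L) (IsCMField.complexConj L) hw ϖ = 0 := pow_eq_zero_iff (two_ne_zero) |>.1 h.symm
  exact galAdicCompletionMap_ne_self_of_uniformizer L v w hw he hϖ (sub_eq_zero.1 hδ).symm

include hw in
/-- **(4a) THE DESCENDED DISCRIMINANT OF A TYPE-(1) ELEMENT IS `(ϖ − σϖ)²` TIMES A SQUARE.**  At a ramified CM place `w ∣ v`: `U ∈ U(Φ₂)(L_w)` with a descent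
`diag(1,a)·U·diag(1,a)⁻¹ = s·ι(g)` (`σ_w a = −a ≠ 0`, `s ≠ 0`, ★ (W1)), distinct NORM-ONE roots `α ≠ γ` of `χ_U` in `L_w` (type (1)), `ϖ` a uniformiser of `L_w` with
Eisenstein datum `ϖ + σϖ = ι u`, `ϖσϖ = −ι v`.  Then there is `z ∈ L⁺_v`, `z ≠ 0`, with **`tr²g − 4·det g = (u² + 4v)·z²`** and **`ι z·(ϖ − σϖ)·s = α − γ`** — the binders
`hz`, `hD` of ★ `exists_torusForm_binders_of_eisenstein_of_deep'` at `τ = ϖ`, and the eigenvalue gap in descended tokens. [cite: LabesseLanglands1979, §2 pp. 7–8] [cite: Rogawski1990, §3.6 pp. 28–29] [cite: Serre1979, Ch. I §6 Prop. 18] -/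
theorem exists_disc_eq_eisenstein_mul_sq_of_typeOne (he : v.asIdeal.ramificationIdx' w.1.asIdeal ≠ 1)
    {a : w.1.adicCompletion L} (ha : galAdicCompletionMap (L := L) (IsCMField.complexConj L) hw a = -a) (ha0 : a ≠ 0)
    {U : GL (Fin 2) (w.1.adicCompletion L)}
    (hU : U ∈ unitaryGroupOfForm (galAdicCompletionMap (L := L) (IsCMField.complexConj L) hw) (placeForm (Matrix.of fun i j : Fin 2 => if i.val + j.val + 1 = 2 then (1 : L) else 0) w.1))
    {s : w.1.adicCompletion L} {g : GL (Fin 2) (v.adicCompletion ↥(maximalRealSubfield L))} (hs : s ≠ 0)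
    (hsg : Matrix.diagonal ![1, a] * (U : Matrix (Fin 2) (Fin 2) (w.1.adicCompletion L)) * Matrix.diagonal ![1, a⁻¹] =
      s • (g : Matrix (Fin 2) (Fin 2) (v.adicCompletion ↥(maximalRealSubfield L))).map (toPlace v w))
    {α γ : w.1.adicCompletion L} (hα : (U : Matrix (Fin 2) (Fin 2) (w.1.adicCompletion L)).charpoly.IsRoot α) (hγ : (U : Matrix (Fin 2) (Fin 2) (w.1.adicCompletion L)).charpoly.IsRoot γ)
    (hαγ : α ≠ γ) (hα1 : α * galAdicCompletionMap (L := L) (IsCMField.complexConj L) hw α = 1) (hγ1 : γ * galAdicCompletionMap (L := L) (IsCMField.complexConj L) hw γ = 1)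
    {ϖ : w.1.adicCompletion L} (hϖ : Valued.v ϖ = WithZero.exp (-1 : ℤ)) {u v' : v.adicCompletion ↥(maximalRealSubfield L)}
    (htr : ϖ + galAdicCompletionMap (L := L) (IsCMField.complexConj L) hw ϖ = toPlace v w u)
    (hnm : ϖ * galAdicCompletionMap (L := L) (IsCMField.complexConj L) hw ϖ = -toPlace v w v') :
    ∃ z : v.adicCompletion ↥(maximalRealSubfield L), z ≠ 0 ∧
      (g : Matrix (Fin 2) (Fin 2) (v.adicCompletion ↥(maximalRealSubfield L))).trace ^ 2 - 4 * (g : Matrix (Fin 2) (Fin 2) (v.adicCompletion ↥(maximalRealSubfield L))).det = (u ^ 2 + 4 * v') * z ^ 2 ∧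
      toPlace v w z * (ϖ - galAdicCompletionMap (L := L) (IsCMField.complexConj L) hw ϖ) * s = α - γ := by
  set σ := galAdicCompletionMap (L := L) (IsCMField.complexConj L) hw with hσdef
  have hc1 : IsCMField.complexConj L ≠ 1 := IsCMField.complexConj_ne_one L
  have hσσ : ∀ x, σ (σ x) = x := galAdicCompletionMap_galAdicCompletionMap_of_smul_eq (IsCMField.complexConj L) w hc1 hw
  have hσι : ∀ y, σ (toPlace v w y) = toPlace v w y := fun y => galAdicCompletionMap_toPlace (IsCMField.complexConj L) w w hw y
  have hU' : U ∈ unitaryGroupOfForm σ !![(0 : w.1.adicCompletion L), 1; 1, 0] := by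
    rw [← unitaryGroupOfForm_placeForm_antidiagTwo_eq L v w σ]; exact hU
  -- `y := (α − γ)∕s` is anti-fixed, `δ := ϖ − σϖ` is anti-fixed and non-zero
  set δ : w.1.adicCompletion L := ϖ - σ ϖ with hδdef
  have hδ0 : δ ≠ 0 := fun h => galAdicCompletionMap_ne_self_of_uniformizer L v w hw he hϖ (sub_eq_zero.1 h).symm
  have hσδ : σ δ = -δ := by rw [hδdef, map_sub, hσσ]; ring
  have hy : σ ((α - γ) / s) = -((α - γ) / s) := map_sub_div_eq_neg_of_descent (toPlace v w) σ hU' ha ha0 hσι hs hsg hα hγ hαγ hα1 hγ1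
  -- `z_E := y∕δ` is fixed, hence descends
  have hzfix : σ ((α - γ) / s / δ) = (α - γ) / s / δ := by rw [map_div₀ σ ((α - γ) / s) δ, hy, hσδ, neg_div_neg_eq]
  obtain ⟨z, hz⟩ := exists_toPlace_eq_of_galAdicCompletionMap_eq (IsCMField.complexConj L) w hc1 hw _ hzfix
  have hzE : toPlace v w z * δ * s = α - γ := by
    rw [hz]; field_simp
  refine ⟨z, ?_, ?_, hzE⟩
  · rintro rfl
    rw [map_zero, zero_mul, zero_mul] at hzE
    exact hαγ (sub_eq_zero.1 hzE.symm)
  · -- compare images under the injective `ι`, after multiplying by `s² ≠ 0`: both sides are `(α − γ)²`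
    apply (toPlace v w).injective
    apply mul_left_cancel₀ (pow_ne_zero 2 hs)
    have hdisc := disc_eq_smul_of_descent (toPlace v w) ha0 hsg
    have htrU := trace_eq_add_of_isRoot_of_isRoot (U : Matrix (Fin 2) (Fin 2) (w.1.adicCompletion L)) hα hγ hαγ
    have hdetU := det_eq_mul_of_isRoot_of_isRoot (U : Matrix (Fin 2) (Fin 2) (w.1.adicCompletion L)) hα hγ hαγ
    rw [htrU, hdetU] at hdisc
    rw [← hdisc, map_mul, toPlace_eisenstein_disc_eq_sq L v w hw htr hnm, map_pow]
    linear_combination (-(α - γ + toPlace v w z * δ * s)) * hzE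

include hw in
/-- **(4b) THE EISENSTEIN DEEPNESS BOUND FROM THE EIGENVALUE DEPTH, valuation form.**  Same descent data; if `|α − γ|_w ≤ |ϖ − σϖ|_w` then
`|tr²g − 4det g|_v ≤ |u² + 4v|_v·|det g|_v` (the binder `hdeep'` of ★ `exists_torusForm_binders_of_eisenstein_of_deep'`, `ValuativeRel` currency): through `ι` and
`|ι x|_w = |x|_v²` this is `|α − γ|²∕|s|² ≤ |ϖ − σϖ|²·|αγ|∕|s|²` with `|α| = |γ| = 1`. [cite: LabesseLanglands1979, §2 pp. 7–8] [cite: Serre1979, Ch. I §6 Prop. 18; Ch. II §2] -/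
theorem valuation_disc_le_of_typeOne_of_le (he : v.asIdeal.ramificationIdx' w.1.asIdeal ≠ 1)
    {a : w.1.adicCompletion L} (ha0 : a ≠ 0)
    {U : GL (Fin 2) (w.1.adicCompletion L)}
    {s : w.1.adicCompletion L} {g : GL (Fin 2) (v.adicCompletion ↥(maximalRealSubfield L))} (hs : s ≠ 0)
    (hsg : Matrix.diagonal ![1, a] * (U : Matrix (Fin 2) (Fin 2) (w.1.adicCompletion L)) * Matrix.diagonal ![1, a⁻¹] =
      s • (g : Matrix (Fin 2) (Fin 2) (v.adicCompletion ↥(maximalRealSubfield L))).map (toPlace v w))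
    {α γ : w.1.adicCompletion L} (hα : (U : Matrix (Fin 2) (Fin 2) (w.1.adicCompletion L)).charpoly.IsRoot α) (hγ : (U : Matrix (Fin 2) (Fin 2) (w.1.adicCompletion L)).charpoly.IsRoot γ)
    (hαγ : α ≠ γ) (hα1 : α * galAdicCompletionMap (L := L) (IsCMField.complexConj L) hw α = 1) (hγ1 : γ * galAdicCompletionMap (L := L) (IsCMField.complexConj L) hw γ = 1)
    {ϖ : w.1.adicCompletion L} {u v' : v.adicCompletion ↥(maximalRealSubfield L)}
    (htr : ϖ + galAdicCompletionMap (L := L) (IsCMField.complexConj L) hw ϖ = toPlace v w u)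
    (hnm : ϖ * galAdicCompletionMap (L := L) (IsCMField.complexConj L) hw ϖ = -toPlace v w v')
    (hle : Valued.v (α - γ) ≤ Valued.v (ϖ - galAdicCompletionMap (L := L) (IsCMField.complexConj L) hw ϖ)) :
    valuation (v.adicCompletion ↥(maximalRealSubfield L))
        ((g : Matrix (Fin 2) (Fin 2) (v.adicCompletion ↥(maximalRealSubfield L))).trace ^ 2 - 4 * (g : Matrix (Fin 2) (Fin 2) (v.adicCompletion ↥(maximalRealSubfield L))).det) ≤
      valuation (v.adicCompletion ↥(maximalRealSubfield L)) (u ^ 2 + 4 * v') *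
        valuation (v.adicCompletion ↥(maximalRealSubfield L)) (g : Matrix (Fin 2) (Fin 2) (v.adicCompletion ↥(maximalRealSubfield L))).det := by
  rw [← map_mul, ← v_le_iff_valuation_le]
  -- pass to `L_w` through `|ι x| = |x|²`
  apply le_of_sq_le_sq_aux
  rw [← valued_toPlace_eq_sq_of_ramified L v w hw he, ← valued_toPlace_eq_sq_of_ramified L v w hw he]
  have hdisc := disc_eq_smul_of_descent (toPlace v w) ha0 hsg
  have hdet := det_eq_smul_of_descent (toPlace v w) ha0 hsg
  have htrU := trace_eq_add_of_isRoot_of_isRoot (U : Matrix (Fin 2) (Fin 2) (w.1.adicCompletion L)) hα hγ hαγ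
  have hdetU := det_eq_mul_of_isRoot_of_isRoot (U : Matrix (Fin 2) (Fin 2) (w.1.adicCompletion L)) hα hγ hαγ
  rw [htrU, hdetU] at hdisc
  rw [hdetU] at hdet
  -- `ι(tr²g − 4det g)·s² = (α − γ)²`, `ι((u² + 4v)·det g)·s² = (ϖ − σϖ)²·αγ`
  have e1 : toPlace v w ((g : Matrix (Fin 2) (Fin 2) (v.adicCompletion ↥(maximalRealSubfield L))).trace ^ 2 -
      4 * (g : Matrix (Fin 2) (Fin 2) (v.adicCompletion ↥(maximalRealSubfield L))).det) * s ^ 2 = (α - γ) ^ 2 := by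
    linear_combination -hdisc
  have e2 : toPlace v w ((u ^ 2 + 4 * v') * (g : Matrix (Fin 2) (Fin 2) (v.adicCompletion ↥(maximalRealSubfield L))).det) * s ^ 2 =
      (ϖ - galAdicCompletionMap (L := L) (IsCMField.complexConj L) hw ϖ) ^ 2 * (α * γ) := by
    rw [map_mul, toPlace_eisenstein_disc_eq_sq L v w hw htr hnm]
    linear_combination (-(ϖ - galAdicCompletionMap (L := L) (IsCMField.complexConj L) hw ϖ) ^ 2) * hdet
  have hvs : 0 < Valued.v (s ^ 2) := (Valuation.pos_iff _).2 (pow_ne_zero _ hs)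
  rw [← mul_le_mul_iff_of_pos_right hvs, ← map_mul, ← map_mul, e1, e2, map_pow, map_mul, map_pow, map_mul,
    valued_eq_one_of_mul_galAdicCompletionMap_eq_one L v w hw hα1, valued_eq_one_of_mul_galAdicCompletionMap_eq_one L v w hw hγ1, mul_one, mul_one]
  exact pow_le_pow_left' hle 2

include hw in
/-- **(4b) THE EISENSTEIN DEEPNESS BOUND FROM THE EIGENVALUE DEPTH `N ≥ d`.**  Same data, with `|α − γ|_w = exp(−N)`, the datum's `|ϖ − σϖ|_w = |ϖ|_w^d` (`|ϖ|_w = exp(−1)`)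
and `d ≤ N`: `|tr²g − 4det g|_v ≤ |u² + 4v|_v·|det g|_v`. [cite: LabesseLanglands1979, §2 pp. 7–8] [cite: Serre1979, Ch. I §6 Prop. 18; Ch. II §2] -/
theorem valuation_disc_le_of_typeOne_of_depth (he : v.asIdeal.ramificationIdx' w.1.asIdeal ≠ 1)
    {a : w.1.adicCompletion L} (ha0 : a ≠ 0)
    {U : GL (Fin 2) (w.1.adicCompletion L)}
    {s : w.1.adicCompletion L} {g : GL (Fin 2) (v.adicCompletion ↥(maximalRealSubfield L))} (hs : s ≠ 0)
    (hsg : Matrix.diagonal ![1, a] * (U : Matrix (Fin 2) (Fin 2) (w.1.adicCompletion L)) * Matrix.diagonal ![1, a⁻¹] =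
      s • (g : Matrix (Fin 2) (Fin 2) (v.adicCompletion ↥(maximalRealSubfield L))).map (toPlace v w))
    {α γ : w.1.adicCompletion L} (hα : (U : Matrix (Fin 2) (Fin 2) (w.1.adicCompletion L)).charpoly.IsRoot α) (hγ : (U : Matrix (Fin 2) (Fin 2) (w.1.adicCompletion L)).charpoly.IsRoot γ)
    (hαγ : α ≠ γ) (hα1 : α * galAdicCompletionMap (L := L) (IsCMField.complexConj L) hw α = 1) (hγ1 : γ * galAdicCompletionMap (L := L) (IsCMField.complexConj L) hw γ = 1)
    {ϖ : w.1.adicCompletion L} (hϖ : Valued.v ϖ = WithZero.exp (-1 : ℤ)) {u v' : v.adicCompletion ↥(maximalRealSubfield L)}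
    (htr : ϖ + galAdicCompletionMap (L := L) (IsCMField.complexConj L) hw ϖ = toPlace v w u)
    (hnm : ϖ * galAdicCompletionMap (L := L) (IsCMField.complexConj L) hw ϖ = -toPlace v w v')
    {d N : ℕ} (hd : Valued.v (ϖ - galAdicCompletionMap (L := L) (IsCMField.complexConj L) hw ϖ) = Valued.v ϖ ^ d)
    (hN : Valued.v (α - γ) = WithZero.exp (-(N : ℤ))) (hdN : d ≤ N) :
    valuation (v.adicCompletion ↥(maximalRealSubfield L))
        ((g : Matrix (Fin 2) (Fin 2) (v.adicCompletion ↥(maximalRealSubfield L))).trace ^ 2 - 4 * (g : Matrix (Fin 2) (Fin 2) (v.adicCompletion ↥(maximalRealSubfield L))).det) ≤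
      valuation (v.adicCompletion ↥(maximalRealSubfield L)) (u ^ 2 + 4 * v') *
        valuation (v.adicCompletion ↥(maximalRealSubfield L)) (g : Matrix (Fin 2) (Fin 2) (v.adicCompletion ↥(maximalRealSubfield L))).det := by
  refine valuation_disc_le_of_typeOne_of_le L v w hw he ha0 hs hsg hα hγ hαγ hα1 hγ1 htr hnm ?_
  rw [hN, hd, hϖ, ← WithZero.exp_nsmul, nsmul_eq_mul, mul_neg, mul_one, WithZero.exp_le_exp]
  omega

end Place

end Literature.NumberTheory.Automorphic.UnitaryGroup

end
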